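import Literature.Geometry.ComplexAnalytic.PhamBrieskornFibreCoordinateRotation
import Literature.Geometry.ComplexAnalytic.PhamBrieskornFibreRotationSum
import Mathlib.LinearAlgebra.Determinant
import HarnessLib

/-!
# The involution `ι : (z₀, z₁, z₂) ↦ (−z₀, z₁, −z₂)` of the Milnor fibre of the cyclic node `z₀² + z₁² + z₂^p = 1` (`p` even):
# `ι_* = −(σ²)_*` for the covering rotation `σ`, and for `p = 4` the `ι`-invariant part of `H₂(F)` is `ker(σ_*² + 1)`
# (Milnor 1968 §9 Thm. 9.1; Sebastiani–Thom for `XY ⊕ S⁴`)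

Family `hodge`, layer `Literature/Geometry/ComplexAnalytic`; sequel of `PhamBrieskornFibreCoordinateRotation` (the sign change of
ONE quadratic coordinate acts as `−1` on `Hₙ₊₁(F)`) and `PhamBrieskornFibreRotationSum` (`Σ_{i<p} σ_*^i = 0`). Written by the
prover seat `hodge-nonav-prover-Ax` (g18) as brick L6-3 «A₃ ⊕ ι LOCAL PACKAGE» of the LOC6 plan for crux K1Q
`VeryGeneralQuaternionCommutatorsInHg` (route `Summits/HodgeConjecture/HodgeConjecture/Theses/Q8SymplecticPowers.lean`, stub S5
`stub_monodromyBireflectionQ`; memo ROUTE-P3v27 §1 (C22), §1b). GEOMETRY (C22): at a d6 point of the quaternionic quartic family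
the normalised `μ₄ × μ₂`-cover is `Z = {XY = S⁴}` (an `A₃` point), the member is `Z/ι` for `ι : (S, X, Y) ↦ (−S, −Y, −X)`, i.e.
`ι(z₀, z₁, z₂) = (−z₀, z₁, −z₂)` in the coordinates `X = z₀ + i z₁, Y = z₀ − i z₁, S = z₂` of the Milnor fibre
`F = {z₀² + z₁² + z₂⁴ = 1}`; the deck generator is the covering rotation `σ : z₂ ↦ ζ₄ z₂`. Milnor / Sebastiani–Thom:
`H₂(F) = H̃₀(Ω₂) ⊗ H̃₀(Ω₂) ⊗ H̃₀(Ω₄)`, `σ_* = 1 ⊗ 1 ⊗ ρ` (eigenvalues `i, −1, −i`), `ι_* = (−1) ⊗ 1 ⊗ ρ² = −σ_*²`, so the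
`ι`-invariant (= descending to the member) vanishing homology is `ker(σ_*² + 1)` (the `±i` eigenlines), of rank `2`, on which `σ_*`
is a complex structure. This file PROVES, on the tree's carriers:

* §1 `PhamBrieskorn.iotaFibre p` (`p` even) — the involution `ι = (z₀ ↦ −z₀) ∘ (z₂ ↦ −z₂)` as a self-homeomorphism of `F`;
  coordinates (`iotaFibre_apply_zero ∕ _one ∕ _last`), `ι ∘ ι = id`, `ι` commutes with every covering rotation `σ_v` and with the
  sign change of the quadratic pair, hence with the model monodromy.
* §2 (any coefficient field of characteristic zero) **`map_iotaFibre_apply`: `ι_* x = −(σ_{−1})_* x`**; for `p = 4` and `ζ` a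
  primitive 4th root of unity, `τ := (σ_ζ)_*`: **`map_iotaFibre_eq_neg_sq`: `ι_* = −τ²`**, **`map_iotaFibre_eq_self_iff`:
  `ι_* x = x ↔ τ² x = −x`**, `τ⁴ = 1`, and **`isCompl_ker_add_one_ker_sq_add_one`: `H₂(F) = ker(τ + 1) ⊕ ker(τ² + 1)`**
  (from `1 + τ + τ² + τ³ = 0`).
* §3 (rational coefficients) `even_finrank_ker_sq_add_one`: `dim_ℚ ker(τ² + 1)` is even (`τ` restricts to a complex structure;
  `det(τ|)² = (−1)^{dim}`), hence **`finrank_ker_sq_add_one_le_two`: `dim_ℚ ker(τ² + 1) ≤ 2`** and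
  `one_le_finrank_ker_add_one` (`dim_ℚ H₂(F; ℚ) = 3`). (The exact values `2` and `1` — Milnor's eigenvalue census `i, −1, −i`
  each once — need the comparison `H₂(F; ℚ) ⊗ ℂ = H₂(F; ℂ)` compatible with induced maps and are not claimed here.)

No HC content; no named fact; rung F-H1 not moved.

## References

* [Milnor1968] J. Milnor, Singular Points of Complex Hypersurfaces, Ann. of Math. Studies 61 (1968), §9, Thm. 9.1 and p. 77.
* [CarlsonToledo1999] J. A. Carlson, D. Toledo, Discriminant complements and kernels of monodromy representations, Duke Math. J.
  97 (1999), §6 (held text p0013–p0014).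
* [Dimca1992] A. Dimca, Singularities and Topology of Hypersurfaces, Springer 1992, Ch. 3 (3.20)–(3.21) (Sebastiani–Thom).
-/

noncomputable section

open Complex ContinuousMap Set CategoryTheory
open Literature.AlgebraicTopology.SingularHomology

namespace Literature.Geometry.ComplexAnalytic

namespace PhamBrieskorn

/-! ### §1 The involution `ι` -/

section Iota

/-- `−1 ∈ Ω_p` for `p` even (in the type of the last exponent of the cyclic node). [cite: Milnor1968, §9 p. 77] -/
theorem neg_one_mem_Omega_cyclicNode_last (p : ℕ) (hpe : Even p) : (-1 : ℂ) ∈ Omega (cyclicNodeExponents p (Fin.last 2)) := by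
  rw [mem_Omega, cyclicNodeExponents_last]; exact Even.neg_one_pow hpe


/-- **The involution `ι : (z₀, z₁, z₂) ↦ (−z₀, z₁, −z₂)` of the Milnor fibre `z₀² + z₁² + z₂^p = 1`** (`p` even): rotation of the
last coordinate by `−1` followed by the sign change of the quadratic coordinate `0` (Carlson–Toledo's `ι : (S, X, Y) ↦ (−S, −Y, −X)` on
`{XY = S⁴ + ε}` in the coordinates `X = z₀ + i z₁`, `Y = z₀ − i z₁`). [cite: CarlsonToledo1999, §6 (held text p0013–p0014)]
[cite: Milnor1968, §9 p. 77] -/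
def iotaFibre (p : ℕ) (hp : p ≠ 0) (hpe : Even p) : fibre (cyclicNodeExponents p) ≃ₜ fibre (cyclicNodeExponents p) :=
  (rotateFibre (cyclicNodeExponents p) (cyclicNodeExponents_ne_zero p hp) ⟨-1, neg_one_mem_Omega_cyclicNode_last p hpe⟩).trans
    (rotateCoordFibre (cyclicNodeExponents p) (cyclicNodeExponents_ne_zero p hp) 0 ⟨-1, neg_one_mem_Omega_of_eq_two rfl⟩)

/-- `ι` as a continuous map is the composite `(z₀ ↦ −z₀) ∘ (z₂ ↦ −z₂)`. [cite: Milnor1968, §9 p. 77] -/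
theorem coe_iotaFibre (p : ℕ) (hp : p ≠ 0) (hpe : Even p) : (iotaFibre p hp hpe : C(fibre (cyclicNodeExponents p), fibre (cyclicNodeExponents p))) =
    (rotateCoordFibre (cyclicNodeExponents p) (cyclicNodeExponents_ne_zero p hp) 0 ⟨-1, neg_one_mem_Omega_of_eq_two rfl⟩ :
        C(fibre (cyclicNodeExponents p), fibre (cyclicNodeExponents p))).comp
      (rotateFibre (cyclicNodeExponents p) (cyclicNodeExponents_ne_zero p hp) ⟨-1, neg_one_mem_Omega_cyclicNode_last p hpe⟩ :
        C(fibre (cyclicNodeExponents p), fibre (cyclicNodeExponents p))) := rfl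

/-- `ι` on points: `ι z = (−1 at 0) · ((−1 at last) · z)`. [cite: Milnor1968, §9 p. 77] -/
theorem iotaFibre_apply_coe (p : ℕ) (hp : p ≠ 0) (hpe : Even p) (z : fibre (cyclicNodeExponents p)) :
    (iotaFibre p hp hpe z : Fin (1 + 2) → ℂ) = rotateCoordFun 0 (-1) (rotateFun (-1) (z : Fin (1 + 2) → ℂ)) := rfl

/-- `(ι z)₀ = −z₀`. [cite: CarlsonToledo1999, §6 (held text p0013–p0014)] -/
theorem iotaFibre_apply_zero (p : ℕ) (hp : p ≠ 0) (hpe : Even p) (z : fibre (cyclicNodeExponents p)) : (iotaFibre p hp hpe z : Fin (1 + 2) → ℂ) 0 = -(z : Fin (1 + 2) → ℂ) 0 := by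
  have h0 : ((0 : Fin 2).castSucc : Fin (1 + 2)) = 0 := rfl
  rw [iotaFibre_apply_coe, rotateCoordFun_apply_same, ← h0, rotateFun_castSucc, neg_one_mul]

/-- `(ι z)₁ = z₁`. [cite: CarlsonToledo1999, §6 (held text p0013–p0014)] -/
theorem iotaFibre_apply_one (p : ℕ) (hp : p ≠ 0) (hpe : Even p) (z : fibre (cyclicNodeExponents p)) : (iotaFibre p hp hpe z : Fin (1 + 2) → ℂ) 1 = (z : Fin (1 + 2) → ℂ) 1 := by
  have h1 : ((1 : Fin 2).castSucc : Fin (1 + 2)) = 1 := rfl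
  have h10 : (1 : Fin (1 + 2)) ≠ 0 := by decide
  rw [iotaFibre_apply_coe, rotateCoordFun_apply_of_ne h10, ← h1, rotateFun_castSucc]

/-- `(ι z)₂ = −z₂`. [cite: CarlsonToledo1999, §6 (held text p0013–p0014)] -/
theorem iotaFibre_apply_last (p : ℕ) (hp : p ≠ 0) (hpe : Even p) (z : fibre (cyclicNodeExponents p)) :
    (iotaFibre p hp hpe z : Fin (1 + 2) → ℂ) (Fin.last 2) = -(z : Fin (1 + 2) → ℂ) (Fin.last 2) := by
  have h20 : (Fin.last 2 : Fin (1 + 2)) ≠ 0 := by decide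
  rw [iotaFibre_apply_coe, rotateCoordFun_apply_of_ne h20]
  exact (rotateFun_last (-1) (z : Fin (1 + 2) → ℂ)).trans (neg_one_mul _)

/-- `ι` is an involution on points. [cite: CarlsonToledo1999, §6 (held text p0013–p0014)] -/
theorem iotaFibre_iotaFibre (p : ℕ) (hp : p ≠ 0) (hpe : Even p) (z : fibre (cyclicNodeExponents p)) :
    iotaFibre p hp hpe (iotaFibre p hp hpe z) = z := by
  refine Subtype.ext (funext fun k => ?_)
  fin_cases k
  · show (iotaFibre p hp hpe (iotaFibre p hp hpe z) : Fin (1 + 2) → ℂ) 0 = (z : Fin (1 + 2) → ℂ) 0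
    rw [iotaFibre_apply_zero, iotaFibre_apply_zero, neg_neg]
  · show (iotaFibre p hp hpe (iotaFibre p hp hpe z) : Fin (1 + 2) → ℂ) 1 = (z : Fin (1 + 2) → ℂ) 1
    rw [iotaFibre_apply_one, iotaFibre_apply_one]
  · show (iotaFibre p hp hpe (iotaFibre p hp hpe z) : Fin (1 + 2) → ℂ) (Fin.last 2) = (z : Fin (1 + 2) → ℂ) (Fin.last 2)
    rw [iotaFibre_apply_last, iotaFibre_apply_last, neg_neg]

/-- `ι ∘ ι = id`. [cite: CarlsonToledo1999, §6 (held text p0013–p0014)] -/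
theorem iotaFibre_comp_iotaFibre (p : ℕ) (hp : p ≠ 0) (hpe : Even p) :
    (iotaFibre p hp hpe : C(fibre (cyclicNodeExponents p), fibre (cyclicNodeExponents p))).comp
        (iotaFibre p hp hpe : C(fibre (cyclicNodeExponents p), fibre (cyclicNodeExponents p))) =
      ContinuousMap.id _ := by
  ext z : 1
  exact iotaFibre_iotaFibre p hp hpe z

/-- `ι` commutes with every covering rotation `σ_v : z₂ ↦ v z₂`. [cite: CarlsonToledo1999, §6 (held text p0013–p0014)] -/
theorem iotaFibre_comp_rotateFibre (p : ℕ) (hp : p ≠ 0) (hpe : Even p) (v : Omega (cyclicNodeExponents p (Fin.last 2))) :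
    (iotaFibre p hp hpe : C(fibre (cyclicNodeExponents p), fibre (cyclicNodeExponents p))).comp
        (rotateFibre (cyclicNodeExponents p) (cyclicNodeExponents_ne_zero p hp) v :
          C(fibre (cyclicNodeExponents p), fibre (cyclicNodeExponents p))) =
      (rotateFibre (cyclicNodeExponents p) (cyclicNodeExponents_ne_zero p hp) v :
          C(fibre (cyclicNodeExponents p), fibre (cyclicNodeExponents p))).comp
        (iotaFibre p hp hpe : C(fibre (cyclicNodeExponents p), fibre (cyclicNodeExponents p))) := by
  ext z : 1
  refine Subtype.ext ?_
  change rotateCoordFun 0 (-1) (rotateFun (-1) (rotateFun (v : ℂ) (z : Fin (1 + 2) → ℂ))) =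
    rotateFun (v : ℂ) (rotateCoordFun 0 (-1) (rotateFun (-1) (z : Fin (1 + 2) → ℂ)))
  simp only [rotateCoordFun, rotateFun]
  ring

/-- Coordinates of the sign change of the quadratic pair: `(−z₀, −z₁, z₂)`. [cite: CarlsonToledo1999, §6 (held text p0013)] -/
theorem negPairFibre_cyclicNode_apply (p : ℕ) (w : fibre (cyclicNodeExponents p)) :
    (negPairFibre (cyclicNodeExponents p) (i := 0) (j := 1) (by decide) rfl rfl w : Fin (1 + 2) → ℂ) 0 = -(w : Fin (1 + 2) → ℂ) 0 ∧
      (negPairFibre (cyclicNodeExponents p) (i := 0) (j := 1) (by decide) rfl rfl w : Fin (1 + 2) → ℂ) 1 = -(w : Fin (1 + 2) → ℂ) 1 ∧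
      (negPairFibre (cyclicNodeExponents p) (i := 0) (j := 1) (by decide) rfl rfl w : Fin (1 + 2) → ℂ) (Fin.last 2) =
        (w : Fin (1 + 2) → ℂ) (Fin.last 2) := by
  refine ⟨?_, ?_, ?_⟩
  · rw [negPairFibre_apply_coe]; exact if_pos (Or.inl rfl)
  · rw [negPairFibre_apply_coe]; exact if_pos (Or.inr rfl)
  · rw [negPairFibre_apply_coe]; exact if_neg (by decide)

/-- `ι` commutes with the sign change of the quadratic pair `(z₀, z₁) ↦ (−z₀, −z₁)`. [cite: CarlsonToledo1999, §6 (held text p0013–p0014)] -/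
theorem iotaFibre_comp_negPairFibre (p : ℕ) (hp : p ≠ 0) (hpe : Even p) :
    (iotaFibre p hp hpe : C(fibre (cyclicNodeExponents p), fibre (cyclicNodeExponents p))).comp
        (negPairFibre (cyclicNodeExponents p) (i := 0) (j := 1) (by decide) rfl rfl :
          C(fibre (cyclicNodeExponents p), fibre (cyclicNodeExponents p))) =
      (negPairFibre (cyclicNodeExponents p) (i := 0) (j := 1) (by decide) rfl rfl :
          C(fibre (cyclicNodeExponents p), fibre (cyclicNodeExponents p))).comp
        (iotaFibre p hp hpe : C(fibre (cyclicNodeExponents p), fibre (cyclicNodeExponents p))) := by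
  ext z : 1
  change iotaFibre p hp hpe (negPairFibre (cyclicNodeExponents p) (i := 0) (j := 1) (by decide) rfl rfl z) =
    negPairFibre (cyclicNodeExponents p) (i := 0) (j := 1) (by decide) rfl rfl (iotaFibre p hp hpe z)
  obtain ⟨hn0, hn1, hn2⟩ := negPairFibre_cyclicNode_apply p z
  obtain ⟨hm0, hm1, hm2⟩ := negPairFibre_cyclicNode_apply p (iotaFibre p hp hpe z)
  refine Subtype.ext (funext fun k => ?_)
  fin_cases k
  · show (iotaFibre p hp hpe _ : Fin (1 + 2) → ℂ) 0 = (negPairFibre (cyclicNodeExponents p) _ _ _ _ : Fin (1 + 2) → ℂ) 0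
    rw [iotaFibre_apply_zero, hn0, hm0, iotaFibre_apply_zero]
  · show (iotaFibre p hp hpe _ : Fin (1 + 2) → ℂ) 1 = (negPairFibre (cyclicNodeExponents p) _ _ _ _ : Fin (1 + 2) → ℂ) 1
    rw [iotaFibre_apply_one, hn1, hm1, iotaFibre_apply_one]
  · show (iotaFibre p hp hpe _ : Fin (1 + 2) → ℂ) (Fin.last 2) =
      (negPairFibre (cyclicNodeExponents p) _ _ _ _ : Fin (1 + 2) → ℂ) (Fin.last 2)
    rw [iotaFibre_apply_last, hn2, hm2, iotaFibre_apply_last]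

/-- Hence `ι` commutes with the model monodromy `(z₀, z₁, z₂) ↦ (−z₀, −z₁, v z₂)` of the smoothing.
[cite: CarlsonToledo1999, §6 (kdoublept) (held text p0013–p0014)] -/
theorem iotaFibre_comp_modelMonodromy (p : ℕ) (hp : p ≠ 0) (hpe : Even p) (v : Omega (cyclicNodeExponents p (Fin.last 2))) :
    (iotaFibre p hp hpe : C(fibre (cyclicNodeExponents p), fibre (cyclicNodeExponents p))).comp
        ((negPairFibre (cyclicNodeExponents p) (i := 0) (j := 1) (by decide) rfl rfl :
            C(fibre (cyclicNodeExponents p), fibre (cyclicNodeExponents p))).comp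
          (rotateFibre (cyclicNodeExponents p) (cyclicNodeExponents_ne_zero p hp) v :
            C(fibre (cyclicNodeExponents p), fibre (cyclicNodeExponents p)))) =
      ((negPairFibre (cyclicNodeExponents p) (i := 0) (j := 1) (by decide) rfl rfl :
            C(fibre (cyclicNodeExponents p), fibre (cyclicNodeExponents p))).comp
          (rotateFibre (cyclicNodeExponents p) (cyclicNodeExponents_ne_zero p hp) v :
            C(fibre (cyclicNodeExponents p), fibre (cyclicNodeExponents p)))).comp
        (iotaFibre p hp hpe : C(fibre (cyclicNodeExponents p), fibre (cyclicNodeExponents p))) := by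
  rw [← ContinuousMap.comp_assoc, iotaFibre_comp_negPairFibre, ContinuousMap.comp_assoc, iotaFibre_comp_rotateFibre,
    ContinuousMap.comp_assoc]

/-- The fixed points of `ι` on `F` are the two points `(0, ±1, 0)`: `ι z = z` iff `z₀ = 0`, `z₂ = 0` (and then `z₁² = 1`).
[cite: CarlsonToledo1999, §6 (held text p0013–p0014)] -/
theorem iotaFibre_eq_self_iff (p : ℕ) (hp : p ≠ 0) (hpe : Even p) (z : fibre (cyclicNodeExponents p)) :
    iotaFibre p hp hpe z = z ↔ (z : Fin (1 + 2) → ℂ) 0 = 0 ∧ (z : Fin (1 + 2) → ℂ) (Fin.last 2) = 0 := by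
  constructor
  · intro h
    have h0 := iotaFibre_apply_zero p hp hpe z
    have h2 := iotaFibre_apply_last p hp hpe z
    rw [h] at h0 h2
    exact ⟨by linear_combination h0 / 2, by linear_combination h2 / 2⟩
  · rintro ⟨h0, h2⟩
    refine Subtype.ext (funext fun k => ?_)
    fin_cases k
    · show (iotaFibre p hp hpe z : Fin (1 + 2) → ℂ) 0 = (z : Fin (1 + 2) → ℂ) 0
      rw [iotaFibre_apply_zero, h0, neg_zero]
    · exact iotaFibre_apply_one p hp hpe z
    · show (iotaFibre p hp hpe z : Fin (1 + 2) → ℂ) (Fin.last 2) = (z : Fin (1 + 2) → ℂ) (Fin.last 2)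
      rw [iotaFibre_apply_last, h2, neg_zero]

end Iota

/-! ### §2 `ι` on homology: `ι_* = −(σ_{−1})_*`, and the case `p = 4` -/

section Homology

/-- A primitive 4th root of unity has `ζ² = −1`. [cite: Milnor1968, §9 p. 77] -/
theorem sq_eq_neg_one_of_isPrimitiveRoot_four {ζ : ℂ} (hζ : IsPrimitiveRoot ζ 4) : ζ ^ 2 = -1 := by
  have h4 : (ζ ^ 2) * (ζ ^ 2) = 1 := by rw [← pow_add]; exact hζ.pow_eq_one
  rcases mul_self_eq_one_iff.1 h4 with h | h
  · exact absurd h (hζ.pow_ne_one_of_pos_of_lt (by norm_num) (by norm_num))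
  · exact h

variable (F : Type) [Field F] (p : ℕ) (hp : p ≠ 0) (hpe : Even p)

/-- **`ι_* x = −(σ_{−1})_* x` on `H₂(F)`** (any coefficient field of characteristic zero): the sign change of the single
quadratic coordinate `z₀` acts as `−1` (`map_rotateCoordFibre_neg_one_apply`). Milnor: `ι_* = (−1) ⊗ 1 ⊗ ρ_{−1}`.
[cite: Milnor1968, §9 Thm. 9.1 and p. 77] [cite: CarlsonToledo1999, §6 (held text p0013–p0014)] -/
theorem map_iotaFibre_apply [CharZero F] (x : singularHomology F F (fibre (cyclicNodeExponents p)) 2) :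
    singularHomology.map F F (iotaFibre p hp hpe : C(fibre (cyclicNodeExponents p), fibre (cyclicNodeExponents p))) 2 x =
      -(singularHomology.map F F
          (rotateFibre (cyclicNodeExponents p) (cyclicNodeExponents_ne_zero p hp) ⟨-1, neg_one_mem_Omega_cyclicNode_last p hpe⟩ :
            C(fibre (cyclicNodeExponents p), fibre (cyclicNodeExponents p))) 2 x) := by
  rw [coe_iotaFibre, singularHomology.map_comp, ModuleCat.comp_apply]
  exact map_rotateCoordFibre_neg_one_apply F (cyclicNodeExponents_ne_zero p hp) (j := 0) rfl _

variable {ζ : ℂ} (hζ : IsPrimitiveRoot ζ 4)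

/-- The rotation `σ_ζ` of `z₂` by the primitive 4th root `ζ`, on `H₂` of the Milnor fibre of `z₀² + z₁² + z₂⁴`, as an
`F`-linear map `τ`. [cite: Milnor1968, §9 p. 77] -/
abbrev tauFour : singularHomology F F (fibre (cyclicNodeExponents 4)) 2 →ₗ[F] singularHomology F F (fibre (cyclicNodeExponents 4)) 2 :=
  (singularHomology.map F F (rotateFibre (cyclicNodeExponents 4) (cyclicNodeExponents_ne_zero 4 four_ne_zero) ⟨ζ, hζ.pow_eq_one⟩ :
    C(fibre (cyclicNodeExponents 4), fibre (cyclicNodeExponents 4))) 2).hom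

/-- `τ² = (σ_{−1})_*`. [cite: Milnor1968, §9 p. 77] -/
theorem tauFour_sq : tauFour F hζ ^ 2 =
    (singularHomology.map F F (rotateFibre (cyclicNodeExponents 4) (cyclicNodeExponents_ne_zero 4 four_ne_zero)
      ⟨-1, neg_one_mem_Omega_cyclicNode_last 4 (by decide)⟩ : C(fibre (cyclicNodeExponents 4), fibre (cyclicNodeExponents 4))) 2).hom := by
  rw [tauFour, map_rotateFibre_pow]
  have h : (⟨ζ ^ 2, by rw [mem_Omega, ← pow_mul, mul_comm, pow_mul, (mem_Omega.1 (⟨ζ, hζ.pow_eq_one⟩ :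
        Omega (cyclicNodeExponents 4 (Fin.last 2))).2), one_pow]⟩ : Omega (cyclicNodeExponents 4 (Fin.last 2))) =
      ⟨-1, neg_one_mem_Omega_cyclicNode_last 4 (by decide)⟩ :=
    Subtype.ext (sq_eq_neg_one_of_isPrimitiveRoot_four hζ)
  rw [h]

/-- `τ⁴ = 1`. [cite: Milnor1968, §9 p. 77] -/
theorem tauFour_pow_four : tauFour F hζ ^ 4 = 1 := by
  rw [tauFour, map_rotateFibre_pow]
  have h : (⟨ζ ^ 4, by rw [mem_Omega, ← pow_mul, mul_comm, pow_mul, (mem_Omega.1 (⟨ζ, hζ.pow_eq_one⟩ :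
        Omega (cyclicNodeExponents 4 (Fin.last 2))).2), one_pow]⟩ : Omega (cyclicNodeExponents 4 (Fin.last 2))) =
      ⟨1, one_mem_Omega _⟩ := Subtype.ext hζ.pow_eq_one
  rw [h, rotateFibre_one, singularHomology.map_id]
  rfl

/-- **`ι_* = −τ²` on `H₂` of the Milnor fibre of `z₀² + z₁² + z₂⁴`** (`τ = (σ_ζ)_*`, `ζ` a primitive 4th root of unity).
[cite: Milnor1968, §9 Thm. 9.1 and p. 77] [cite: CarlsonToledo1999, §6 (held text p0013–p0014)] -/
theorem map_iotaFibre_eq_neg_sq [CharZero F] (x : singularHomology F F (fibre (cyclicNodeExponents 4)) 2) :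
    singularHomology.map F F (iotaFibre 4 four_ne_zero (by decide) : C(fibre (cyclicNodeExponents 4), fibre (cyclicNodeExponents 4))) 2 x =
      -((tauFour F hζ ^ 2) x) := by
  rw [map_iotaFibre_apply, tauFour_sq]

/-- **The `ι`-invariant classes are exactly `ker(τ² + 1)`**: `ι_* x = x ↔ τ² x = −x`.
[cite: Milnor1968, §9 Thm. 9.1 and p. 77] [cite: CarlsonToledo1999, §6 (held text p0013–p0014)] -/
theorem map_iotaFibre_eq_self_iff [CharZero F] (x : singularHomology F F (fibre (cyclicNodeExponents 4)) 2) :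
    singularHomology.map F F (iotaFibre 4 four_ne_zero (by decide) : C(fibre (cyclicNodeExponents 4), fibre (cyclicNodeExponents 4))) 2 x =
      x ↔ (tauFour F hζ ^ 2) x = -x := by
  rw [map_iotaFibre_eq_neg_sq F hζ, neg_eq_iff_eq_neg]

/-- `1 + τ + τ² + τ³ = 0` on `H₂(F)` (the tree's `sum_pow_map_rotateFibre_eq_zero` for `p = 4`). [cite: Milnor1968, §9 Thm. 9.1] -/
theorem tauFour_sum_eq_zero [CharZero F] (x : singularHomology F F (fibre (cyclicNodeExponents 4)) 2) :
    x + tauFour F hζ x + (tauFour F hζ ^ 2) x + (tauFour F hζ ^ 3) x = 0 := by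
  have h := sum_pow_map_rotateFibre_eq_zero F (cyclicNodeExponents_ne_zero 4 four_ne_zero) (a := cyclicNodeExponents 4) hζ x
  change ∑ i ∈ Finset.range 4, (tauFour F hζ ^ i) x = 0 at h
  simp only [Finset.sum_range_succ, Finset.sum_range_zero, zero_add, pow_zero, pow_one, Module.End.one_apply] at h
  exact h

/-- `(τ + 1) ((τ² + 1) x) = 0`. [cite: Milnor1968, §9 Thm. 9.1] -/
theorem tauFour_add_one_sq_add_one [CharZero F] (x : singularHomology F F (fibre (cyclicNodeExponents 4)) 2) :
    tauFour F hζ ((tauFour F hζ ^ 2) x + x) + ((tauFour F hζ ^ 2) x + x) = 0 := by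
  have h := tauFour_sum_eq_zero F hζ x
  rw [map_add, ← Module.End.mul_apply, ← pow_succ']
  rw [← h]
  abel

/-- **`H₂(F) = ker(τ + 1) ⊕ ker(τ² + 1)`** for the Milnor fibre of `z₀² + z₁² + z₂⁴` over any field of characteristic zero
(`(τ + 1)(τ² + 1) = Σ_{i<4} τ^i = 0`, and `(X² + 1) − (X + 1)(X − 1) = 2` is a unit): the `−1`-eigenspace of the covering rotation and
the `ι`-invariant part. [cite: Milnor1968, §9 Thm. 9.1 and p. 77] -/
theorem isCompl_ker_add_one_ker_sq_add_one [CharZero F] :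
    IsCompl (LinearMap.ker (tauFour F hζ + 1)) (LinearMap.ker (tauFour F hζ ^ 2 + 1)) := by
  set τ := tauFour F hζ with hτ
  have h2 : (2 : F) ≠ 0 := two_ne_zero
  have hτ4 : ∀ x, (τ ^ 2) ((τ ^ 2) x) = x := fun x => by
    rw [← Module.End.mul_apply, ← pow_add]
    change (τ ^ 4) x = x
    rw [hτ, tauFour_pow_four]; rfl
  refine isCompl_iff.2 ⟨?_, ?_⟩
  · rw [Submodule.disjoint_def]
    intro x hx1 hx2
    rw [LinearMap.mem_ker, LinearMap.add_apply, Module.End.one_apply] at hx1 hx2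
    have hτx : τ x = -x := eq_neg_of_add_eq_zero_left hx1
    have hτ2x : (τ ^ 2) x = x := by rw [pow_two, Module.End.mul_apply, hτx, map_neg, hτx, neg_neg]
    rw [hτ2x] at hx2
    have h2x : (2 : F) • x = 0 := by rw [two_smul]; exact hx2
    exact (smul_eq_zero.1 h2x).resolve_left h2
  · rw [codisjoint_iff, eq_top_iff]
    intro x _
    -- `x = (x + τ²x)/2 + (x − τ²x)/2`
    refine Submodule.mem_sup.2 ⟨(2 : F)⁻¹ • ((τ ^ 2) x + x), ?_, (2 : F)⁻¹ • (x - (τ ^ 2) x), ?_, ?_⟩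
    · rw [LinearMap.mem_ker, LinearMap.add_apply, Module.End.one_apply, map_smul, ← smul_add, tauFour_add_one_sq_add_one,
        smul_zero]
    · rw [LinearMap.mem_ker, LinearMap.add_apply, Module.End.one_apply, map_smul, ← smul_add, map_sub, hτ4,
        sub_add_sub_cancel, sub_self, smul_zero]
    · rw [← smul_add]
      have : (τ ^ 2) x + x + (x - (τ ^ 2) x) = (2 : F) • x := by rw [two_smul]; abel
      rw [this, smul_smul, inv_mul_cancel₀ h2, one_smul]

/-- `τ` preserves `ker(τ² + 1)` and squares to `−1` there. [cite: Milnor1968, §9 Thm. 9.1 and p. 77] -/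
theorem tauFour_mem_ker_sq_add_one {x : singularHomology F F (fibre (cyclicNodeExponents 4)) 2}
    (hx : x ∈ LinearMap.ker (tauFour F hζ ^ 2 + 1)) :
    tauFour F hζ x ∈ LinearMap.ker (tauFour F hζ ^ 2 + 1) ∧ tauFour F hζ (tauFour F hζ x) = -x := by
  rw [LinearMap.mem_ker, LinearMap.add_apply, Module.End.one_apply] at hx ⊢
  have h : tauFour F hζ (tauFour F hζ x) = -x := by
    rw [← Module.End.mul_apply, ← pow_two]; exact eq_neg_of_add_eq_zero_left hx
  refine ⟨?_, h⟩
  rw [pow_two, Module.End.mul_apply, h, map_neg, neg_add_cancel]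

end Homology

/-! ### §3 Rational coefficients: `dim_ℚ ker(τ² + 1)` is even, hence `≤ 2` -/

section Rational

variable {ζ : ℂ} (hζ : IsPrimitiveRoot ζ 4)

/-- `H₂(F; ℚ)` of the Milnor fibre of `z₀² + z₁² + z₂⁴` is finite-dimensional (dimension `3`). [cite: Milnor1968, §9 Thm. 9.1] -/
theorem finite_rat_singularHomology_fibre_cyclicNode_four :
    Module.Finite ℚ (singularHomology ℚ ℚ (fibre (cyclicNodeExponents 4)) 2) :=
  Module.finite_of_finrank_pos (by rw [finrank_rat_singularHomology_fibre_cyclicNode 4 four_ne_zero]; norm_num)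

/-- **`dim_ℚ ker(τ² + 1)` is even**: `τ` restricts to an endomorphism `J` of `W = ker(τ² + 1)` with `J² = −1`, so
`det(J)² = det(−1_W) = (−1)^{dim W}` is a square in `ℚ`, forcing `dim W` even. [cite: Milnor1968, §9 Thm. 9.1 and p. 77] -/
theorem even_finrank_ker_sq_add_one : Even (Module.finrank ℚ (LinearMap.ker (tauFour ℚ hζ ^ 2 + 1))) := by
  haveI := finite_rat_singularHomology_fibre_cyclicNode_four
  set W := LinearMap.ker (tauFour ℚ hζ ^ 2 + 1) with hW
  have hmem : ∀ x ∈ W, tauFour ℚ hζ x ∈ W := fun x hx => (tauFour_mem_ker_sq_add_one ℚ hζ hx).1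
  set J : W →ₗ[ℚ] W := (tauFour ℚ hζ).restrict hmem with hJ
  have hJJ : J * J = (-1 : ℚ) • LinearMap.id := by
    refine LinearMap.ext fun x => Subtype.ext ?_
    rw [Module.End.mul_apply, LinearMap.smul_apply, LinearMap.id_apply, Submodule.coe_smul, neg_one_smul,
      hJ, LinearMap.coe_restrict_apply, LinearMap.coe_restrict_apply]
    exact (tauFour_mem_ker_sq_add_one ℚ hζ x.2).2
  have hdet : LinearMap.det J * LinearMap.det J = (-1 : ℚ) ^ Module.finrank ℚ W := by
    rw [← map_mul, hJJ, LinearMap.det_smul, LinearMap.det_id, mul_one]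
  by_contra hodd
  rw [Nat.not_even_iff_odd] at hodd
  rw [hodd.neg_one_pow] at hdet
  have h := mul_self_nonneg (LinearMap.det J)
  rw [hdet] at h
  norm_num at h

/-- **`dim_ℚ ker(τ² + 1) ≤ 2`** and the complementary `dim_ℚ ker(τ + 1) ≥ 1` (`dim_ℚ H₂(F; ℚ) = 3`, the decomposition
`isCompl_ker_add_one_ker_sq_add_one`, evenness). [cite: Milnor1968, §9 Thm. 9.1 and p. 77] -/
theorem finrank_ker_sq_add_one_le_two : Module.finrank ℚ (LinearMap.ker (tauFour ℚ hζ ^ 2 + 1)) ≤ 2 := by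
  haveI := finite_rat_singularHomology_fibre_cyclicNode_four
  have hsum := Submodule.finrank_add_eq_of_isCompl (isCompl_ker_add_one_ker_sq_add_one ℚ hζ)
  rw [finrank_rat_singularHomology_fibre_cyclicNode 4 four_ne_zero] at hsum
  obtain ⟨k, hk⟩ := even_finrank_ker_sq_add_one hζ
  omega

/-- `dim_ℚ ker(τ + 1) ≥ 1`: the covering rotation has a rational anti-invariant class. [cite: Milnor1968, §9 Thm. 9.1 and p. 77] -/
theorem one_le_finrank_ker_add_one : 1 ≤ Module.finrank ℚ (LinearMap.ker (tauFour ℚ hζ + 1)) := by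
  haveI := finite_rat_singularHomology_fibre_cyclicNode_four
  have hsum := Submodule.finrank_add_eq_of_isCompl (isCompl_ker_add_one_ker_sq_add_one ℚ hζ)
  rw [finrank_rat_singularHomology_fibre_cyclicNode 4 four_ne_zero] at hsum
  have h2 := finrank_ker_sq_add_one_le_two hζ
  omega

end Rational

end PhamBrieskorn

end Literature.Geometry.ComplexAnalytic

end
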